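import Mathlib
import Literature.Analysis.PDE.SingleEntropy.OleinikEntropy
import HarnessLib

/-!
# Oleĭnik's one-sided bound implies the entropy inequalities, III: `C¹` convex entropies

Topic `Literature/Analysis/PDE/SingleEntropy` — part of the formalization of
De Lellis–Otto–Westdickenberg, *Minimal entropy conditions for Burgers equation*, Quart. Appl.
Math. 62 (2004) 687–700, Thm 2.3 / Cor 2.5 (the named fact
`Literature.Analysis.PDE.deLellisOttoWestdickenberg_singleEntropy`).

`entropy_of_oneSided`: the conclusion of `entropy_of_oneSided_C2` for every `C¹` convex entropy
`η` (flux `q' = f' η'`), by approximating `η` with its one-dimensional mollifications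
`β̄ₙ ⋆ η` (smooth, with monotone derivative `β̄ₙ ⋆ η'`) and fluxes `q(0) + ∫₀ʷ f' (β̄ₙ ⋆ η')`,
and dominated convergence. [folklore]
-/

noncomputable section

open MeasureTheory Set Filter Metric ContinuousLinearMap
open scoped Topology Convolution NNReal

namespace Literature.Analysis.PDE.SingleEntropy

/-! ## `C¹` convex entropies by approximation -/

section C1Entropy

variable (β : ContDiffBump (0 : ℝ))

/-- Integration by parts on the line, compactly supported right factor. [folklore] -/
theorem ibp_right_real {A B : ℝ → ℝ} (hA : ContDiff ℝ 1 A) (hB : ContDiff ℝ 1 B)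
    (hBc : HasCompactSupport B) :
    ∫ x, A x * deriv B x = -∫ x, deriv A x * B x := by
  have hA' : Continuous fun x => fderiv ℝ A x 1 :=
    (hA.continuous_fderiv one_ne_zero).clm_apply continuous_const
  have hB' : Continuous fun x => fderiv ℝ B x 1 :=
    (hB.continuous_fderiv one_ne_zero).clm_apply continuous_const
  have h := integral_mul_fderiv_eq_neg_fderiv_mul_of_integrable (μ := volume) (v := (1 : ℝ))
    (f := A) (g := B) ?_ ?_ ?_ (fun x _ => hA.differentiable one_ne_zero x)
    (fun x _ => hB.differentiable one_ne_zero x)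
  · simpa only [fderiv_apply_one_eq_deriv] using h
  · exact (hA'.mul hB.continuous).integrable_of_hasCompactSupport
      (hBc.mono (fun x hx => by intro h0; exact hx (by simp [h0])))
  · exact (hA.continuous.mul hB').integrable_of_hasCompactSupport
      ((hBc.fderiv_apply ℝ 1).mono (fun x hx => by
        intro h0
        apply hx
        show A x * fderiv ℝ B x 1 = 0
        have h0' : fderiv ℝ B x 1 = 0 := h0
        rw [h0', mul_zero]))
  · exact (hA.continuous.mul hB.continuous).integrable_of_hasCompactSupport
      (hBc.mono (fun x hx => by intro h0; exact hx (by simp [h0])))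

/-- Integral formula for the one-dimensional mollification `β̄ ⋆ g`. [folklore] -/
theorem bumpConv_apply (g : ℝ → ℝ) (w : ℝ) :
    (β.normed volume ⋆[lsmul ℝ ℝ, volume] g) w = ∫ t, β.normed volume t * g (w - t) := by
  rw [convolution_def]
  simp [lsmul_apply, smul_eq_mul]

/-- Derivative of the mollification of a `C¹` function: `(β̄ ⋆ g)' = β̄ ⋆ g'`. [folklore] -/
theorem deriv_bumpConv {g : ℝ → ℝ} (hg : ContDiff ℝ 1 g) (w : ℝ) :
    deriv (β.normed volume ⋆[lsmul ℝ ℝ, volume] g) w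
      = (β.normed volume ⋆[lsmul ℝ ℝ, volume] deriv g) w := by
  have hli : LocallyIntegrable g volume := hg.continuous.locallyIntegrable
  have H := (β.hasCompactSupport_normed (μ := volume)).hasDerivAt_convolution_left (lsmul ℝ ℝ)
    (β.contDiff_normed (n := 1)) hli w
  rw [H.deriv, convolution_def, bumpConv_apply]
  simp only [lsmul_apply, smul_eq_mul]
  have hA : ContDiff ℝ 1 (fun t => g (w - t)) := hg.comp (contDiff_const.sub contDiff_id)
  have hdA : ∀ t, deriv (fun t => g (w - t)) t = -deriv g (w - t) := by
    intro t
    have h2 : HasDerivAt (fun t => g (w - t)) (deriv g (w - t) * (0 - 1)) t :=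
      ((hg.differentiable one_ne_zero) (w - t)).hasDerivAt.comp t
        ((hasDerivAt_const t w).sub (hasDerivAt_id t))
    rw [h2.deriv]
    ring
  have key := ibp_right_real hA (β.contDiff_normed (n := 1))
    (β.hasCompactSupport_normed (μ := volume))
  simp_rw [hdA] at key
  calc ∫ t, deriv (β.normed volume) t * g (w - t)
      = ∫ t, g (w - t) * deriv (β.normed volume) t := by
        congr 1; funext t; ring
    _ = -∫ t, -deriv g (w - t) * β.normed volume t := key
    _ = ∫ t, β.normed volume t * deriv g (w - t) := by
        rw [← integral_neg]; congr 1; funext t; ring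

/-- Local sup bound for the one-dimensional mollification. [folklore] -/
theorem abs_bumpConv_le {g : ℝ → ℝ} {w A : ℝ} (hA : ∀ y ∈ ball w β.rOut, |g y| ≤ A) :
    |(β.normed volume ⋆[lsmul ℝ ℝ, volume] g) w| ≤ A := by
  rw [bumpConv_apply]
  have hint : Integrable (fun t => β.normed volume t) volume := β.integrable_normed
  have hpt : ∀ t, |β.normed volume t * g (w - t)| ≤ β.normed volume t * A := by
    intro t
    rw [abs_mul, abs_of_nonneg (β.nonneg_normed _)]
    by_cases ht : β.normed volume t = 0
    · simp [ht]
    · apply mul_le_mul_of_nonneg_left _ (β.nonneg_normed _)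
      apply hA
      have : t ∈ Function.support (β.normed volume) := ht
      rw [β.support_normed_eq, mem_ball_zero_iff] at this
      rw [mem_ball, dist_eq_norm]
      simpa using this
  calc |∫ t, β.normed volume t * g (w - t)|
      ≤ ∫ t, |β.normed volume t * g (w - t)| := abs_integral_le_integral_abs
    _ ≤ ∫ t, β.normed volume t * A := by
        apply integral_mono_of_nonneg (ae_of_all _ fun t => abs_nonneg _) (hint.mul_const A)
        exact ae_of_all _ hpt
    _ = A := by rw [integral_mul_const, β.integral_normed, one_mul]

/-- The mollification of a function with monotone derivative has monotone derivative. [folklore] -/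
theorem monotone_bumpConv {g : ℝ → ℝ} (hg : Continuous g) (hmono : Monotone g) :
    Monotone (β.normed volume ⋆[lsmul ℝ ℝ, volume] g) := by
  intro w₁ w₂ hw
  rw [bumpConv_apply, bumpConv_apply]
  have hi : ∀ w, Integrable (fun t => β.normed volume t * g (w - t)) volume := fun w =>
    (β.continuous_normed.mul (hg.comp (continuous_const.sub continuous_id)))
      |>.integrable_of_hasCompactSupport
      ((β.hasCompactSupport_normed (μ := volume)).mono
        (fun x hx => by intro h0; exact hx (by simp [h0])))
  exact integral_mono (hi w₁) (hi w₂) fun t =>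
    mul_le_mul_of_nonneg_left (hmono (by linarith)) (β.nonneg_normed _)

end C1Entropy


/-- Points of `Ι 0 w` are bounded by `|w|`. [folklore] -/
theorem abs_le_abs_of_mem_uIoc {s w : ℝ} (hs : s ∈ Set.uIoc 0 w) : |s| ≤ |w| := by
  rcases Set.mem_uIoc.mp hs with ⟨h1, h2⟩ | ⟨h1, h2⟩
  · rw [abs_of_pos h1]
    exact h2.trans (le_abs_self w)
  · rw [abs_of_nonpos h2, abs_of_neg (h1.trans_le h2)]
    linarith

/-- **One-sided Lipschitz bound ⇒ all convex entropy inequalities (`C¹` entropies).** As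
`entropy_of_oneSided_C2`, for every `C¹` convex entropy `η` with flux `q' = f' η'`: approximate
`η` by its mollifications `β̄ₙ ⋆ η` (smooth, with monotone derivative `β̄ₙ ⋆ η'`, hence convex),
with fluxes `q(0) + ∫₀ʷ f' (β̄ₙ ⋆ η')`, apply the `C²` statement and pass to the limit by dominated
convergence. [folklore] -/
theorem entropy_of_oneSided {f η q : ℝ → ℝ} (hf : ContDiff ℝ 2 f)
    (hfc : ∀ w, 0 ≤ deriv (deriv f) w) (hη : ContDiff ℝ 1 η) (hηc : ConvexOn ℝ univ η)
    (hq : ∀ w, HasDerivAt q (deriv f w * deriv η w) w)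
    {Ω : Set (ℝ × ℝ)} (hΩ : IsOpen Ω) {u : ℝ × ℝ → ℝ} (hu : Measurable u) {M : ℝ}
    (huM : ∀ p, |u p| ≤ M)
    (hws : ∀ φ : ℝ × ℝ → ℝ, ContDiff ℝ (⊤ : ℕ∞) φ → HasCompactSupport φ → tsupport φ ⊆ Ω →
      ∫ p in Ω, (u p * deriv (fun t => φ (t, p.2)) p.1
        + f (u p) * deriv (fun x => φ (p.1, x)) p.2) = 0)
    (hol : ∀ p ∈ Ω, ∃ C r : ℝ, 0 < r ∧ ∀ ψ : ℝ × ℝ → ℝ, ContDiff ℝ (⊤ : ℕ∞) ψ →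
      HasCompactSupport ψ → tsupport ψ ⊆ ball p r → (∀ z, 0 ≤ ψ z) →
        -(C * ∫ z, ψ z) ≤ ∫ z, u z * fderiv ℝ ψ z (0, 1))
    {φ : ℝ × ℝ → ℝ} (hφ : ContDiff ℝ (⊤ : ℕ∞) φ) (hφc : HasCompactSupport φ)
    (hφΩ : tsupport φ ⊆ Ω) (hφ0 : ∀ p, 0 ≤ φ p) :
    0 ≤ ∫ p in Ω, (η (u p) * deriv (fun t => φ (t, p.2)) p.1
      + q (u p) * deriv (fun x => φ (p.1, x)) p.2) := by
  have hφ1 : Differentiable ℝ φ := hφ.differentiable (by simp)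
  have hφC1 : ContDiff ℝ 1 φ := hφ.of_le (by simp)
  rw [setIntegral_pairing_eq_integral hφΩ, integral_pairing_eq_fderiv hφ1]
  have hη1 : Differentiable ℝ η := hη.differentiable one_ne_zero
  have hη'c : Continuous (deriv η) := hη.continuous_deriv le_rfl
  have hη'm : Monotone (deriv η) :=
    monotoneOn_univ.mp (hηc.monotoneOn_deriv (fun x _ => hη1 x))
  have hf'c : Continuous (deriv f) := hf.continuous_deriv (by norm_num)
  -- the bumps
  let βs : ℕ → ContDiffBump (0 : ℝ) := fun n =>
    ⟨1 / (2 * ((n : ℝ) + 2)), 1 / ((n : ℝ) + 2), by positivity, by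
      rw [div_lt_div_iff_of_pos_left one_pos (by positivity) (by positivity)]; linarith⟩
  have hbOut : ∀ n, (βs n).rOut = 1 / ((n : ℝ) + 2) := fun n => rfl
  have hb_lt : ∀ n, (βs n).rOut < 1 := fun n => by
    rw [hbOut, div_lt_iff₀ (by positivity)]; nlinarith
  have hb_tend : Tendsto (fun n => (βs n).rOut) atTop (𝓝 0) := by
    have h1 : Tendsto (fun n : ℕ => (1 : ℝ) / ((n : ℝ) + 2)) atTop (𝓝 0) := by
      have := (tendsto_const_div_atTop_nhds_zero_nat (1 : ℝ)).comp (tendsto_add_atTop_nat 2)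
      refine this.congr (fun n => ?_)
      simp [Function.comp]
    exact h1
  -- the approximants
  set E : ℕ → ℝ → ℝ := fun n => (βs n).normed volume ⋆[lsmul ℝ ℝ, volume] η with hEdef
  set D : ℕ → ℝ → ℝ := fun n => (βs n).normed volume ⋆[lsmul ℝ ℝ, volume] deriv η with hDdef
  set Q : ℕ → ℝ → ℝ := fun n w => q 0 + ∫ s in (0 : ℝ)..w, deriv f s * D n s with hQdef
  have hEs : ∀ n, ContDiff ℝ (⊤ : ℕ∞) (E n) := fun n =>
    ((βs n).hasCompactSupport_normed (μ := volume)).contDiff_convolution_left (lsmul ℝ ℝ)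
      (βs n).contDiff_normed hη.continuous.locallyIntegrable
  have hEd : ∀ n, deriv (E n) = D n := fun n => funext fun w => deriv_bumpConv (βs n) hη w
  have hDm : ∀ n, Monotone (D n) := fun n => monotone_bumpConv (βs n) hη'c hη'm
  have hDc : ∀ n, Continuous (D n) := fun n => by
    rw [← hEd n]; exact (hEs n).continuous_deriv (by simp)
  have hE2 : ∀ n, ContDiff ℝ 2 (E n) := fun n => (hEs n).of_le (by norm_cast)
  have hEdd : ∀ n w, 0 ≤ deriv (deriv (E n)) w := fun n w => by
    rw [hEd n]; exact (hDm n).deriv_nonneg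
  have hQd : ∀ n w, HasDerivAt (Q n) (deriv f w * deriv (E n) w) w := fun n w => by
    rw [hEd n]
    have hc : Continuous fun s => deriv f s * D n s := hf'c.mul (hDc n)
    have h1 := (hc.integral_hasStrictDerivAt 0 w).hasDerivAt
    exact h1.const_add (q 0)
  have hQc : ∀ n, Continuous (Q n) := fun n =>
    continuous_iff_continuousAt.2 fun w => (hQd n w).continuousAt
  -- each approximant satisfies the inequality
  have step : ∀ n, 0 ≤ ∫ p, (E n (u p) * fderiv ℝ φ p (1, 0)
      + Q n (u p) * fderiv ℝ φ p (0, 1)) := by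
    intro n
    have := entropy_of_oneSided_C2 hf hfc (hE2 n) (hEdd n) (hQd n) hΩ hu huM hws hol hφ hφc
      hφΩ hφ0
    rwa [setIntegral_pairing_eq_integral hφΩ, integral_pairing_eq_fderiv hφ1] at this
  -- pointwise convergence of the approximants
  have hElim : ∀ w, Tendsto (fun n => E n w) atTop (𝓝 (η w)) := fun w =>
    ContDiffBump.convolution_tendsto_right_of_continuous hb_tend hη.continuous w
  have hDlim : ∀ w, Tendsto (fun n => D n w) atTop (𝓝 (deriv η w)) := fun w =>
    ContDiffBump.convolution_tendsto_right_of_continuous hb_tend hη'c w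
  -- local bounds
  have hball : ∀ n (w y : ℝ) (R : ℝ), |w| ≤ R → y ∈ ball w (βs n).rOut → |y| ≤ R + 1 := by
    intro n w y R hw hy
    rw [mem_ball, dist_eq_norm, Real.norm_eq_abs] at hy
    have := hb_lt n
    have h1 : |y| ≤ |y - w| + |w| := by
      have := abs_add_le (y - w) w
      simpa using this
    linarith
  have hEb : ∀ n (w R A : ℝ), (∀ y, |y| ≤ R + 1 → |η y| ≤ A) → |w| ≤ R → |E n w| ≤ A :=
    fun n w R A hA hw => abs_bumpConv_le (βs n) (fun y hy => hA y (hball n w y R hw hy))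
  have hDb : ∀ n (w R A : ℝ), (∀ y, |y| ≤ R + 1 → |deriv η y| ≤ A) → |w| ≤ R → |D n w| ≤ A :=
    fun n w R A hA hw => abs_bumpConv_le (βs n) (fun y hy => hA y (hball n w y R hw hy))
  -- convergence of the fluxes
  have hQlim : ∀ w, Tendsto (fun n => Q n w) atTop (𝓝 (q w)) := by
    intro w
    have hqw : q w = q 0 + ∫ s in (0 : ℝ)..w, deriv f s * deriv η s := by
      rw [intervalIntegral.integral_eq_sub_of_hasDerivAt (fun s _ => hq s)
        ((hf'c.mul hη'c).intervalIntegrable 0 w)]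
      ring
    rw [hqw]
    refine tendsto_const_nhds.add ?_
    obtain ⟨Afw, hAfw0, hAfw⟩ := exists_abs_le_on_Icc hf'c |w|
    obtain ⟨A2w, hA2w0, hA2w⟩ := exists_abs_le_on_Icc hη'c (|w| + 1)
    refine intervalIntegral.tendsto_integral_filter_of_dominated_convergence
      (fun _ => Afw * A2w) ?_ ?_ ?_ ?_
    · exact Eventually.of_forall fun n => (hf'c.mul (hDc n)).aestronglyMeasurable
    · refine Eventually.of_forall fun n => ae_of_all _ fun s hs => ?_
      have hs' : |s| ≤ |w| := abs_le_abs_of_mem_uIoc hs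
      rw [norm_mul, Real.norm_eq_abs, Real.norm_eq_abs]
      exact mul_le_mul (hAfw s hs') (hDb n s |w| A2w hA2w hs') (abs_nonneg _) hAfw0
    · exact intervalIntegrable_const
    · exact ae_of_all _ fun s _ => tendsto_const_nhds.mul (hDlim s)
  -- global bounds on `[-M, M]`
  obtain ⟨A1, hA10, hA1⟩ := exists_abs_le_on_Icc hη.continuous (M + 1)
  obtain ⟨A2, hA20, hA2⟩ := exists_abs_le_on_Icc hη'c (M + 1)
  obtain ⟨Af, hAf0, hAf⟩ := exists_abs_le_on_Icc hf'c M
  have hM0 : ∀ p, 0 ≤ M := fun p => (abs_nonneg _).trans (huM p)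
  have hQb : ∀ n w, |w| ≤ M → |Q n w| ≤ |q 0| + Af * A2 * M := by
    intro n w hw
    have hM : 0 ≤ M := (abs_nonneg _).trans hw
    have h1 : ‖∫ s in (0 : ℝ)..w, deriv f s * D n s‖ ≤ Af * A2 * |w - 0| := by
      apply intervalIntegral.norm_integral_le_of_norm_le_const
      intro s hs
      have hs' : |s| ≤ M := (abs_le_abs_of_mem_uIoc hs).trans hw
      rw [norm_mul, Real.norm_eq_abs, Real.norm_eq_abs]
      exact mul_le_mul (hAf s hs') (hDb n s M A2 hA2 hs') (abs_nonneg _) hAf0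
    rw [sub_zero, Real.norm_eq_abs] at h1
    calc |Q n w| = |q 0 + ∫ s in (0 : ℝ)..w, deriv f s * D n s| := rfl
      _ ≤ |q 0| + |∫ s in (0 : ℝ)..w, deriv f s * D n s| := abs_add_le _ _
      _ ≤ |q 0| + Af * A2 * |w| := by linarith
      _ ≤ |q 0| + Af * A2 * M := by nlinarith [mul_nonneg hAf0 hA20]
  -- dominated convergence over the plane
  have cφt : Continuous fun p => fderiv ℝ φ p (1, 0) :=
    (hφC1.continuous_fderiv one_ne_zero).clm_apply continuous_const
  have cφx : Continuous fun p => fderiv ℝ φ p (0, 1) :=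
    (hφC1.continuous_fderiv one_ne_zero).clm_apply continuous_const
  have hz3 : ∀ p ∉ tsupport φ, fderiv ℝ φ p (1, 0) = 0 ∧ fderiv ℝ φ p (0, 1) = 0 :=
    fun p hp => ⟨by simp [fderiv_of_notMem_tsupport ℝ hp],
      by simp [fderiv_of_notMem_tsupport ℝ hp]⟩
  have lim : Tendsto (fun n => ∫ p, (E n (u p) * fderiv ℝ φ p (1, 0)
      + Q n (u p) * fderiv ℝ φ p (0, 1))) atTop
      (𝓝 (∫ p, (η (u p) * fderiv ℝ φ p (1, 0) + q (u p) * fderiv ℝ φ p (0, 1)))) := by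
    refine tendsto_integral_of_dominated_convergence
      (fun p => A1 * ‖fderiv ℝ φ p (1, 0)‖ + (|q 0| + Af * A2 * M) * ‖fderiv ℝ φ p (0, 1)‖)
      ?_ ?_ ?_ ?_
    · intro n
      exact ((((hEs n).continuous.measurable.comp hu).mul cφt.measurable).add
        (((hQc n).measurable.comp hu).mul cφx.measurable)).aestronglyMeasurable
    · apply Continuous.integrable_of_hasCompactSupport (by fun_prop)
      exact HasCompactSupport.of_support_subset_isCompact hφc (fun p hp => by
        by_contra h
        exact hp (by simp [(hz3 p h).1, (hz3 p h).2]))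
    · intro n
      refine ae_of_all _ fun p => ?_
      have h1 : ‖E n (u p)‖ ≤ A1 := by
        rw [Real.norm_eq_abs]; exact hEb n (u p) M A1 hA1 (huM p)
      have h2 : ‖Q n (u p)‖ ≤ |q 0| + Af * A2 * M := by
        rw [Real.norm_eq_abs]; exact hQb n (u p) (huM p)
      calc ‖E n (u p) * fderiv ℝ φ p (1, 0) + Q n (u p) * fderiv ℝ φ p (0, 1)‖
          ≤ ‖E n (u p) * fderiv ℝ φ p (1, 0)‖ + ‖Q n (u p) * fderiv ℝ φ p (0, 1)‖ :=
            norm_add_le _ _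
        _ = ‖E n (u p)‖ * ‖fderiv ℝ φ p (1, 0)‖ + ‖Q n (u p)‖ * ‖fderiv ℝ φ p (0, 1)‖ := by
            rw [norm_mul, norm_mul]
        _ ≤ A1 * ‖fderiv ℝ φ p (1, 0)‖ + (|q 0| + Af * A2 * M) * ‖fderiv ℝ φ p (0, 1)‖ := by
            gcongr
    · exact ae_of_all _ fun p =>
        ((hElim (u p)).mul tendsto_const_nhds).add ((hQlim (u p)).mul tendsto_const_nhds)
  exact ge_of_tendsto' lim step


end Literature.Analysis.PDE.SingleEntropy
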